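import Mathlib
import Summits.NavierStokesRegularity.NavierStokesRegularity.Theorems.EulerZoomLiouvillePowerGaugeEulerLiouvilleBootstrapEnergy
import Summits.NavierStokesRegularity.NavierStokesRegularity.Theorems.EulerZoomLiouvillePowerGaugeEulerLiouvilleEnergyVanishingTools
import HarnessLib

/-!
# Rung C2 of the crux `EulerZoomLiouville.PowerGaugeEulerLiouville` at the endpoint `ρ = 1/2`:
# a DISCRETELY self-similar member has a.e. CONSTANT total energy

Route №10 `EulerZoomLiouville` (NavierStokesRegularity), crux E = stmt-NavierStokesRegularity-19832,
tenure rung C2 (`Sig.rungC2_dss`) at the energy-conserving endpoint `ρ = 1/2`.  At the endpoint every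
member of Seregin's class has finite total energy `E(τ) = ∫ |u(τ)|² ≤ c` (`lintegral_enorm_sq_le_of_gauge_half`)
and the energy is a.e. NON-INCREASING (the lead's global energy inequality
`lintegral_enorm_sq_antitone_ae_of_gauge`).  For a DISCRETELY self-similar member
(`u(τ, y) = l^{3/2} u(l^{5/2} τ, l y)`, `l > 1`) the energy is moreover exactly LOG-PERIODIC,
`E(l^{5/2} τ) = E(τ)`; a non-increasing log-periodic function is constant:

* `lintegral_enorm_sq_dss_half` — `E(l^{5/2} τ) = E(τ)` (`τ < 0`);
* `dss_half_energy_ae_const` — **there is `E₀ ≤ c` with `E(τ) = E₀` for a.e. `τ < 0`.**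
  (For a.e. `s` the set `{E > E(s)}` is null in `(s, 0)`, invariant under `τ ↦ l^{5/2} τ`, hence null
  in `(−∞, 0)`; so `ess sup E ≤ E(s)`, while `E ≤ ess sup E` a.e.)

So at the endpoint a DSS member, like an exactly self-similar one, neither gains nor loses energy: it is the
natural input of «constant energy ⇒ local energy EQUALITY» (sequel `…DSSEndpointLocalEnergyEquality`).
WHAT THIS IS NOT: not NS, not E, not rung C2 — structure of DSS endpoint members, `--supports` stmt-19832.
-/

noncomputable section

-- flat `Theorems/<Route><Decl>…` files of one crux share the namespace of the crux (tree convention)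
set_option linter.dupNamespace false

open MeasureTheory Set Filter Topology Metric Function TopologicalSpace
open scoped ENNReal NNReal InnerProductSpace RealInnerProductSpace Pointwise

namespace Summit.NavierStokesRegularity.NavierStokesRegularity.Theorems.PowerGaugeEulerLiouville

open Literature.Analysis Literature.Analysis.FunctionSpaces Literature.Analysis.FluidPDE

section EnergyConst

variable {u : ℝ → EuclideanSpace ℝ (Fin 3) → EuclideanSpace ℝ (Fin 3)}
  {p : ℝ → EuclideanSpace ℝ (Fin 3) → ℝ}
  {H : ℝ → EuclideanSpace ℝ (Fin 3) → EuclideanSpace ℝ (Fin 3) →L[ℝ] EuclideanSpace ℝ (Fin 3)}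
  {c : ℝ≥0}

/-- Lebesgue integral under a dilation of `ℝ³`: `∫ f(r y) dy = |r|⁻³ ∫ f` (`r ≠ 0`). [folklore] -/
theorem lintegral_comp_smul_euclidean_three (f : EuclideanSpace ℝ (Fin 3) → ℝ≥0∞) {r : ℝ} (hr : r ≠ 0) :
    ∫⁻ y, f (r • y) = ENNReal.ofReal (|(r ^ 3)⁻¹|) * ∫⁻ y, f y := by
  set e : EuclideanSpace ℝ (Fin 3) ≃ᵐ EuclideanSpace ℝ (Fin 3) :=
    (Homeomorph.smul (isUnit_iff_ne_zero.2 hr).unit).toMeasurableEquiv with he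
  have hmap : Measure.map (⇑e) (volume : Measure (EuclideanSpace ℝ (Fin 3))) =
      ENNReal.ofReal (|(r ^ Module.finrank ℝ (EuclideanSpace ℝ (Fin 3)))⁻¹|) • volume := by
    rw [show (⇑e) = fun x : EuclideanSpace ℝ (Fin 3) => r • x from rfl]
    exact Measure.map_addHaar_smul volume hr
  have h := lintegral_map_equiv f e (μ := (volume : Measure (EuclideanSpace ℝ (Fin 3))))
  rw [hmap, lintegral_smul_measure, finrank_euclideanSpace_fin, smul_eq_mul] at h
  exact h.symm

/-- **The energy of a DSS member at the endpoint is log-periodic:** for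
`u(τ, y) = l^{3/2} u(l^{5/2} τ, l y)` (`τ < 0`, `l > 0`), `∫ |u(l^{5/2} τ)|² = ∫ |u(τ)|²`. [folklore] -/
theorem lintegral_enorm_sq_dss_half {l : ℝ} (hl : 0 < l)
    (hu : ∀ τ : ℝ, τ < 0 → ∀ y, u τ y = (l ^ (3 / 2 : ℝ)) • u (l ^ (5 / 2 : ℝ) * τ) (l • y))
    {τ : ℝ} (hτ : τ < 0) :
    ∫⁻ y, ‖u (l ^ (5 / 2 : ℝ) * τ) y‖ₑ ^ 2 = ∫⁻ y, ‖u τ y‖ₑ ^ 2 := by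
  set a : ℝ := l ^ (3 / 2 : ℝ) with ha
  set b : ℝ := l ^ (5 / 2 : ℝ) with hb
  have ha0 : 0 < a := Real.rpow_pos_of_pos hl _
  have hrel : ∀ y, u (b * τ) y = a⁻¹ • u τ (l⁻¹ • y) := by
    intro y
    have h1 := hu τ hτ (l⁻¹ • y)
    rw [smul_smul, mul_inv_cancel₀ hl.ne', one_smul] at h1
    rw [h1, smul_smul, inv_mul_cancel₀ ha0.ne', one_smul]
  have h2 : ∀ y, ‖u (b * τ) y‖ₑ ^ 2 = ENNReal.ofReal (a⁻¹ ^ 2) * ‖u τ (l⁻¹ • y)‖ₑ ^ 2 := by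
    intro y
    rw [hrel y, enorm_smul, mul_pow, Real.enorm_eq_ofReal (by positivity), ENNReal.ofReal_pow (by positivity)]
  simp_rw [h2]
  rw [lintegral_const_mul' _ _ ENNReal.ofReal_ne_top,
    lintegral_comp_smul_euclidean_three (fun y => ‖u τ y‖ₑ ^ 2) (inv_ne_zero hl.ne'), ← mul_assoc,
    ← ENNReal.ofReal_mul (by positivity)]
  have e : a⁻¹ ^ 2 * |(l⁻¹ ^ 3)⁻¹| = 1 := by
    rw [inv_pow l 3, inv_inv, abs_of_pos (pow_pos hl 3), inv_pow, ha, ← Real.rpow_natCast,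
      ← Real.rpow_mul hl.le, ← Real.rpow_neg hl.le, ← Real.rpow_natCast l 3, ← Real.rpow_add hl]
    norm_num
  rw [e, ENNReal.ofReal_one, one_mul]

/-- **A DSS member at the endpoint has a.e. constant total energy.**  Let `(u, p, H, c)` satisfy the three
hypotheses of the crux at `ρ = 1/2` and be discretely self-similar with factor `l > 1`
(`u(τ,y) = l^{3/2} u(l^{5/2}τ, l y)`).  Then there is `E₀ ≤ c` with `∫ |u(τ)|² = E₀` for a.e. `τ < 0`.
(Non-increasing a.e. by the lead's global energy inequality, log-periodic by `lintegral_enorm_sq_dss_half`.)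
[folklore] -/
theorem dss_half_energy_ae_const
    (hsw : IsSuitableWeakSolutionOn (slab (EuclideanSpace ℝ (Fin 3)) (Iio 0) isOpen_Iio) 0 0 u p)
    (hH : HasWeakSpatialGradientOn (slab (EuclideanSpace ℝ (Fin 3)) (Iio 0) isOpen_Iio) u H)
    (hgauge : ∀ a : ℝ, 0 < a →
      ENNReal.ofReal (a ^ (2 * (1 / 2 : ℝ))) * cknA a (0 : ℝ × EuclideanSpace ℝ (Fin 3)) u +
          ENNReal.ofReal (a ^ (1 / 2 : ℝ)) * cknE a (0 : ℝ × EuclideanSpace ℝ (Fin 3)) H +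
        ENNReal.ofReal (a ^ (2 * (1 / 2 : ℝ))) * cknD a (0 : ℝ × EuclideanSpace ℝ (Fin 3)) p ≤ (c : ℝ≥0∞))
    {l : ℝ} (hl : 1 < l)
    (hu : ∀ τ : ℝ, τ < 0 → ∀ y, u τ y = (l ^ (3 / 2 : ℝ)) • u (l ^ (5 / 2 : ℝ) * τ) (l • y)) :
    ∃ E₀ : ℝ≥0∞, E₀ ≤ c ∧ ∀ᵐ τ : ℝ, τ < 0 → ∫⁻ y, ‖u τ y‖ₑ ^ 2 = E₀ := by
  have hl0 : 0 < l := by linarith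
  set b : ℝ := l ^ (5 / 2 : ℝ) with hb
  have hb1 : 1 < b := Real.one_lt_rpow hl (by norm_num)
  have hb0 : 0 < b := by linarith
  set g : ℝ → ℝ≥0∞ := fun τ => ∫⁻ y, ‖u τ y‖ₑ ^ 2 with hg
  -- finite energy, a.e. monotonicity, log-periodicity
  have hA : ∀ a : ℝ, 0 < a → ENNReal.ofReal (a ^ (2 * (1 / 2 : ℝ))) *
      cknA a (0 : ℝ × EuclideanSpace ℝ (Fin 3)) u ≤ (c : ℝ≥0∞) :=
    fun a ha => le_trans (le_trans le_self_add le_self_add) (hgauge a ha)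
  have hfin : ∀ τ : ℝ, τ < 0 → g τ ≤ c := fun τ hτ => lintegral_enorm_sq_le_of_gauge_half hA hτ
  have hanti := lintegral_enorm_sq_antitone_ae_of_gauge (ρ := 1 / 2) (by norm_num) hsw hH hgauge
  have hper : ∀ τ : ℝ, τ < 0 → g (b * τ) = g τ := fun τ hτ => lintegral_enorm_sq_dss_half hl0 hu hτ
  have hper' : ∀ (j : ℕ) (τ : ℝ), τ < 0 → g (b ^ j * τ) = g τ := by
    intro j
    induction j with
    | zero => intro τ _; simp
    | succ j ih =>
      intro τ hτ
      have hτ' : b ^ j * τ < 0 := mul_neg_of_pos_of_neg (pow_pos hb0 j) hτ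
      rw [pow_succ, mul_comm (b ^ j) b, mul_assoc, hper _ hτ', ih τ hτ]
  -- the essential supremum on the slab
  set μ : Measure ℝ := volume.restrict (Iio (0 : ℝ)) with hμ
  set c₀ : ℝ≥0∞ := essSup g μ with hc₀
  have hle : ∀ᵐ τ ∂μ, g τ ≤ c₀ := ENNReal.ae_le_essSup g
  have hc₀c : c₀ ≤ c :=
    essSup_le_of_ae_le _ ((ae_restrict_iff' measurableSet_Iio).2 (Eventually.of_forall hfin))
  refine ⟨c₀, hc₀c, ?_⟩
  -- for a good `s`, `g ≤ g s` a.e. on the slab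
  have hkey : ∀ s : ℝ, s < 0 → (∀ᵐ t : ℝ, t ∈ Ioo s 0 → g t ≤ g s) → ∀ᵐ t ∂μ, g t ≤ g s := by
    intro s hs hs'
    set N : Set ℝ := {t | g s < g t} with hN
    have hN0 : volume (N ∩ Ioo s 0) = 0 := by
      rw [ae_iff] at hs'
      refine measure_mono_null (fun t ht => ?_) hs'
      exact fun h => (not_le.2 ht.1) (h ht.2)
    -- `N ∩ (−∞,0) ⊆ ⋃_j b^j • (N ∩ (s,0))`
    have hcover : N ∩ Iio 0 ⊆ ⋃ j : ℕ, (b ^ j) • (N ∩ Ioo s 0) := by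
      rintro t ⟨htN, ht0⟩
      have ht0' : 0 < -t := neg_pos.2 ht0
      -- choose `j` with `b^j > t/s`... i.e. `t / b^j ∈ (s, 0)`
      obtain ⟨j, hj⟩ := pow_unbounded_of_one_lt (t / s) hb1
      refine mem_iUnion.2 ⟨j, ?_⟩
      rw [mem_smul_set_iff_inv_smul_mem₀ (pow_ne_zero j hb0.ne'), smul_eq_mul]
      have hbj : 0 < b ^ j := pow_pos hb0 j
      refine ⟨?_, ?_, ?_⟩
      · show g s < g ((b ^ j)⁻¹ * t)
        have h1 := hper' j ((b ^ j)⁻¹ * t) (mul_neg_of_pos_of_neg (inv_pos.2 hbj) ht0)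
        rw [← mul_assoc, mul_inv_cancel₀ hbj.ne', one_mul] at h1
        have h2 : g s < g t := htN
        rw [← h1]; exact h2
      · -- `s < t / b^j`
        rw [inv_mul_eq_div, lt_div_iff₀ hbj]
        have h1 : t / s < b ^ j := hj
        rw [div_lt_iff_of_neg hs] at h1
        linarith
      · exact mul_neg_of_pos_of_neg (inv_pos.2 hbj) ht0
    have hNslab : volume (N ∩ Iio 0) = 0 := by
      refine measure_mono_null hcover (measure_iUnion_null fun j => ?_)
      rw [Measure.addHaar_smul, hN0, mul_zero]
    rw [hμ, ae_restrict_iff' measurableSet_Iio, ae_iff]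
    refine measure_mono_null (fun t ht => ?_) hNslab
    have ht' : ¬ (t ∈ Iio (0 : ℝ) → g t ≤ g s) := ht
    rw [Classical.not_imp, not_le] at ht'
    exact ⟨ht'.2, ht'.1⟩
  -- conclusion
  have hgood : ∀ᵐ s : ℝ, s < 0 → c₀ ≤ g s := by
    filter_upwards [hanti] with s hs hs0
    exact essSup_le_of_ae_le _ (hkey s hs0 (hs hs0))
  have hle' : ∀ᵐ τ : ℝ, τ < 0 → g τ ≤ c₀ := (ae_restrict_iff' measurableSet_Iio).1 hle
  filter_upwards [hgood, hle'] with τ h1 h2 hτ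
  exact le_antisymm (h2 hτ) (h1 hτ)

end EnergyConst

end Summit.NavierStokesRegularity.NavierStokesRegularity.Theorems.PowerGaugeEulerLiouville
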